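import Summits.ABC.IUTFork.Cor312LogKummerRoute
import Summits.ABC.IUTFork.Thm311LogvolInvariance
import HarnessLib

/-!
# [IUTchIII] Cor. 3.12, TEAM B row B-3: admissibility (and volume `m`-independence) of the single
# Kummer images — `ThetaRegionsAdm` from lattice-carrying realisations

Record-only file (D-0012) of the abc-iut cell (Cor. 3.12 strategy TEAM B «estimate / log-Kummer» of
HUMAN RULING D-0067 (3), row B-3 of `HOME/plan/C312-TEAMS.md`, seat abc-iut-c312-12 = B2); TAKES NO
SIDE. abc-iut-c312-11's log-Kummer route (`Cor312LogKummerRoute`, p411119) reduces the printed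
`Statement` of Cor. 3.12 to `BridgeHyps` + TWO named hypotheses, of which the first —
`Cor312Vol.ThetaRegionsAdm P`: every `(n,m)`-Kummer image of the Θ-pilot object is an admissible region
of Thm. 3.11 (i) (a) — is marked "discharge over the real instances = row B-3". This file discharges it
under the same single-Haar-container reading as rows B-2/B-4 (`Cor312IndVolumeReal` p411395,
`Cor312KummerVolumeReal` p411464):

* `Cor312Vol.thetaRegionsAdm_of_latticeRealisations` — **`ThetaRegionsAdm P` HOLDS** if the mono-analytic
  admissibility reads as "positive finite normalised Haar volume of the container image", each `m`-th
  Kummer isomorphism is realised on the container by a homeomorphism mapping SOME integral structure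
  onto itself ([IUTchIII] Prop. 3.1 (ii): the Kummer isomorphisms respect the integral structures;
  Dupuy–Hilado §4.7 "fixes the lattice"), the image of each Kummer transport is the realisation of ONE
  étale-side reference region (`thetaRegion m = ψ_m(R)` on the containers — [IUTchIII] Thm. 3.11 (ii)
  (a): the images "of the `m`-th transport of the Θ-pilot region"), and the reference region has
  positive finite volume ([IUTchIII] Prop. 3.9 (i): "nonempty compact open subsets"). By Haar
  uniqueness each image then has positive finite volume too.
* `Cor312Vol.logvol_thetaRegion_eq_of_latticeRealisations` — under the same data with the log-volume
  reading, **the log-volume of the `m`-th Kummer image does not depend on `m`** (every one equals the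
  reference's): the region-level form of Thm. 3.11 (ii)'s final "[precisely!]" clause / Prop. 3.9 (iv),
  which reduces the `∃ m` of the route's `VolumeTransport` to the `m = 0` comparison.

Sources read on the page: [IUTchIII] p. 92 (Prop. 3.1 (ii)), pp. 115–117 (Prop. 3.9 (i), (ii), (iv)),
pp. 155–156 (Thm. 3.11 (ii)), p. 184 (Step (xi-g)); Dupuy–Hilado §4.7.
[claim: Mochizuki2012, status: disputed] [cite: DupuyHilado2025, §4.7]
Deliberately NOT here: `VolumeTransport` itself (the route's B-INPUT — the adjudication target, never
asserted), `BridgeHyps` (team A row A-0), the instance data (which `ψ_m`/`R` realise the printed Kummer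
isomorphisms is c312-3's W2-G / c312-5's `Real.*` instance claim), any judgement on Cor. 3.12.
-/

noncomputable section

open Set
open Literature.IUT.LogVolume

namespace Summit.ABC

namespace IUTFork

namespace Cor312Vol

open Thm311 Cor312 Literature.IUT.LogThetaLattice

variable {T : ThetaIndex} {S : Situation T} (P : Cor312.Setting S)
variable {W : T.Label → T.VQ → Type*} [∀ j vQ, AddCommGroup (W j vQ)]
  [∀ j vQ, TopologicalSpace (W j vQ)] [∀ j vQ, IsTopologicalAddGroup (W j vQ)]
  [∀ j vQ, MeasurableSpace (W j vQ)] [∀ j vQ, BorelSpace (W j vQ)]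
  (Λ : ∀ j vQ, IntegralStructure (W j vQ)) (d : T.Label → T.VQ → ℕ)
  (e : ∀ (j : T.Label) (vQ : T.VQ), S.L.Packet j vQ → W j vQ)
  (ψ : ℤ → ∀ (j : T.Label) (vQ : T.VQ), W j vQ ≃ₜ+ W j vQ)
  (R : ∀ (j : T.Label) (vQ : T.VQ), Set (S.L.Packet j vQ))

/-- **`ThetaRegionsAdm` from lattice-carrying realisations** ([IUTchIII] Prop. 3.9 (i)–(ii), Rmk. 3.9.5
(ix); row B-3): with admissibility read as positive finite normalised Haar volume of the container
image, realisations `ψ_m` of the Kummer isomorphisms mapping some integral structure onto itself, the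
`m`-th Kummer image of the Θ-pilot object realised as `ψ_m` of one étale-side reference region `R`, and
`R` of positive finite volume at the labels of `𝔽_l^⋇` — every single Kummer image is admissible:
`Cor312Vol.ThetaRegionsAdm P` (the first named hypothesis of c312-11's log-Kummer route).
[claim: Mochizuki2012, status: disputed] -/
theorem thetaRegionsAdm_of_latticeRealisations
    (hAdm : ∀ (j : T.Label) (vQ : T.VQ) (A : Set (S.L.Packet j vQ)),
      (S.D P.n).Adm j vQ A ↔ 0 < (Λ j vQ).haar (e j vQ '' A) ∧ (Λ j vQ).haar (e j vQ '' A) < ⊤)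
    (hψ : ∀ (m : ℤ) (j : T.Label) (vQ : T.VQ), ∃ Λ₀ : IntegralStructure (W j vQ),
      ψ m j vQ '' (Λ₀ : Set (W j vQ)) = (Λ₀ : Set (W j vQ)))
    (hthetaEq : ∀ (m : ℤ) (i : Fin T.lstar) (vQ : T.VQ),
      e (Setting.labelSucc i) vQ '' P.thetaRegion m (Setting.labelSucc i) vQ =
        ψ m (Setting.labelSucc i) vQ '' (e (Setting.labelSucc i) vQ '' R (Setting.labelSucc i) vQ))
    (hR : ∀ (i : Fin T.lstar) (vQ : T.VQ),
      0 < (Λ (Setting.labelSucc i) vQ).haar (e (Setting.labelSucc i) vQ '' R (Setting.labelSucc i) vQ) ∧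
        (Λ (Setting.labelSucc i) vQ).haar (e (Setting.labelSucc i) vQ '' R (Setting.labelSucc i) vQ) < ⊤) :
    ThetaRegionsAdm P := by
  intro m i vQ
  obtain ⟨Λ₀, hΛ₀⟩ := hψ m (Setting.labelSucc i) vQ
  rw [hAdm, hthetaEq m i vQ,
    (Λ (Setting.labelSucc i) vQ).haar_image_of_preserves (ψ m (Setting.labelSucc i) vQ) Λ₀ hΛ₀]
  exact hR i vQ

/-- **The single-image log-volumes do not depend on `m`** (the region-level form of Thm. 3.11 (ii)'s
final "[precisely!]" clause, Prop. 3.9 (iv)): under the same data with the log-volume read through the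
containers, every `m`-th Kummer image of the Θ-pilot object has EXACTLY the log-volume of the
reference region — so the `∃ m` of the route's `VolumeTransport` reduces to the `m = 0` comparison.
[claim: Mochizuki2012, status: disputed] -/
theorem logvol_thetaRegion_eq_of_latticeRealisations
    (hlogvol : ∀ (j : T.Label) (vQ : T.VQ) (A : Set (S.L.Packet j vQ)),
      (S.D P.n).logvol j vQ A = (Λ j vQ).normalizedLogVolume (d j vQ) (e j vQ '' A))
    (hψ : ∀ (m : ℤ) (j : T.Label) (vQ : T.VQ), ∃ Λ₀ : IntegralStructure (W j vQ),
      ψ m j vQ '' (Λ₀ : Set (W j vQ)) = (Λ₀ : Set (W j vQ)))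
    (hthetaEq : ∀ (m : ℤ) (i : Fin T.lstar) (vQ : T.VQ),
      e (Setting.labelSucc i) vQ '' P.thetaRegion m (Setting.labelSucc i) vQ =
        ψ m (Setting.labelSucc i) vQ '' (e (Setting.labelSucc i) vQ '' R (Setting.labelSucc i) vQ))
    (m m' : ℤ) (i : Fin T.lstar) (vQ : T.VQ) :
    (S.D P.n).logvol (Setting.labelSucc i) vQ (P.thetaRegion m (Setting.labelSucc i) vQ) =
      (S.D P.n).logvol (Setting.labelSucc i) vQ (P.thetaRegion m' (Setting.labelSucc i) vQ) := by
  obtain ⟨Λ₀, hΛ₀⟩ := hψ m (Setting.labelSucc i) vQ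
  obtain ⟨Λ₀', hΛ₀'⟩ := hψ m' (Setting.labelSucc i) vQ
  rw [hlogvol, hlogvol, hthetaEq m i vQ, hthetaEq m' i vQ,
    (Λ (Setting.labelSucc i) vQ).normalizedLogVolume_image_of_preserves (d (Setting.labelSucc i) vQ)
      (ψ m (Setting.labelSucc i) vQ) Λ₀ hΛ₀,
    (Λ (Setting.labelSucc i) vQ).normalizedLogVolume_image_of_preserves (d (Setting.labelSucc i) vQ)
      (ψ m' (Setting.labelSucc i) vQ) Λ₀' hΛ₀']

/-- **The `∃ m` of the route's B-INPUT collapses**: under the realisation data the single-image volumes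
are `m`-independent, so `VolumeTransport` (SOME lattice position works per packet) is EQUIVALENT to its
uniform form `VolumeTransportAt m₀` at ANY fixed position — e.g. the gluing position of Step (xi-a).
The adjudication target is thereby pinned to ONE comparison per packet.
[claim: Mochizuki2012, status: disputed] -/
theorem volumeTransport_iff_at_of_latticeRealisations
    (hlogvol : ∀ (j : T.Label) (vQ : T.VQ) (A : Set (S.L.Packet j vQ)),
      (S.D P.n).logvol j vQ A = (Λ j vQ).normalizedLogVolume (d j vQ) (e j vQ '' A))
    (hψ : ∀ (m : ℤ) (j : T.Label) (vQ : T.VQ), ∃ Λ₀ : IntegralStructure (W j vQ),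
      ψ m j vQ '' (Λ₀ : Set (W j vQ)) = (Λ₀ : Set (W j vQ)))
    (hthetaEq : ∀ (m : ℤ) (i : Fin T.lstar) (vQ : T.VQ),
      e (Setting.labelSucc i) vQ '' P.thetaRegion m (Setting.labelSucc i) vQ =
        ψ m (Setting.labelSucc i) vQ '' (e (Setting.labelSucc i) vQ '' R (Setting.labelSucc i) vQ))
    (m₀ : ℤ) : VolumeTransport P ↔ VolumeTransportAt P m₀ := by
  constructor
  · intro h i vQ
    obtain ⟨m, hm⟩ := h i vQ
    calc P.qLocal (Setting.labelSucc i) vQ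
        ≤ (S.D P.n).logvol (Setting.labelSucc i) vQ (P.thetaRegion m (Setting.labelSucc i) vQ) := hm
      _ = (S.D P.n).logvol (Setting.labelSucc i) vQ (P.thetaRegion m₀ (Setting.labelSucc i) vQ) :=
        logvol_thetaRegion_eq_of_latticeRealisations P Λ d e ψ R hlogvol hψ hthetaEq m m₀ i vQ
  · exact volumeTransport_of_at

end Cor312Vol

end IUTFork

end Summit.ABC

end
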